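import Summits.QuantumFields.YangMills.Theorems.LuscherReductionTwistedTraceScalingBOKernel
import Summits.QuantumFields.YangMills.Theorems.LuscherReductionTwistedTraceScalingAvgKernelColourBased
import Summits.QuantumFields.YangMills.Theorems.TwistedTraceScaling.Negative.AvgKernelStiffFlip
import Summits.QuantumFields.YangMills.Theorems.LuscherReductionTwistedTraceScalingColourAverageChart
import HarnessLib

/-!
# The GLOBAL-COLOUR Faddeev–Popov identity and the localised BO kernel: (B-T) ⟸ a pointwise comparison of `fpBOKernel` with the RAW one-site kernel
# (lane A of S-BASE, crux `TwistedTraceScaling` stmt-QuantumFields-20203, C4-CORE; design note `pub/ym-fleet/ym-luscher-20007-p1/COARSE-DESIGN.md` §25)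

The Laplace evaluation of the gauge-orbit integral `K̃_β(U,V) = ∫ K_β(U, V^g) dg` behind (B-T) must NOT expand in the constant (global colour) mode of `g`: on the window
`{orbitDist₁ < β^{-s}}` the one-site colour integral is itself degenerate (near-commuting slow links), and it is exactly the colour average of the one-site kernel
`K̃₁^{(B)}(u,u') = ∫ K₁^{(B)}(u, cu'c⁻¹) dc` that (B-T) compares with — so it is never evaluated.  The based split `g = c·h`, `h(0) = 1` (`avgKernel_eq_colour_based`) pins
the wrong representative (the phase of `h ↦ K(U, c·V^h·c⁻¹)` has a linear term `β·Σ_k Re tr(Ξ·[u'_k⁻¹u_k − u_k u'_k⁻¹])` in `Ξ = Σ_x ξ(x)`, of size `β^{1−2s}`, §25.2).  The right tool is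
the Faddeev–Popov identity for the GLOBAL colour action with an arbitrary gauge-fixing weight `W` whose colour-orbit integral is constant:
* §1 ★★ `integral_gaugeMeasure_fp` — `Z·∫ F(g) dg = ∫_c ∫_g F(c·g) W(g) dg dc` whenever `∫_c W(c·g) dc = Z` for all `g` (Fubini + left/inversion invariance of Haar; no
  Jacobian, no chart); `fp_weight_of_equivariant` — `W = Θ ∘ μ` with `μ(c·g) = c·μ(g)` has this property with `Z = ∫ Θ` (right invariance).  The weight of record for the
  Laplace step is `Θ = 𝟙_{B_ε(1)}`, `μ` = polar mean of `Σ_x q(g_x)` (the slice `Σ_x ξ_x = 0` kills the linear term EXACTLY in the orthographic chart), `ε = β^{-1}`.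
* §2 ★ `avgKernel_fp` — `Z·K̃_β(U,V) = ∫_c ∫_g W(g) K_β(c⁻¹Uc, V^g) dg dc`; `avgKernel_one_eq_integral_conj` — `K̃₁^{(B)}(u,u') = ∫_c K₁^{(B)}(c⁻¹uc, u') dc`.
* §3 `fpBOKernel β Ω W u u' = ∫∫ Ω(v) (∫_g W(g) K_β(orthoTube u v, (orthoTube u' v')^g) dg) Ω(v') dπ dπ'` (the COLOUR-LOCALISED BO kernel) and ★★ `boKernel_fp`:
  `Z·𝒦_β(u,u') = ∫_c fpBOKernel(c⁻¹uc, u') dc` for colour-blind `Ω` (conjugation equivariance of the orthographic tube — cdisprove's `R33.gaugeTransform_const_orthoTube` —, `Ad`-invariance of `π` and `Ω`).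
* (sequel `…BTColourFPReduction`: ★★★ `boKernel_pointwise_of_fp`, ★★★ `hT_of_fp` — a two-sided POINTWISE bound `|fpBOKernel(u,u') − C·K₁^{(B)}(u,u')| ≤ κ·C·K₁^{(B)}(u,u')`
  on the window gives the hypothesis of `hT_of_pointwise` (p654332) with constant `C/Z`, hence `RecordAnalyticInput.hT` with `σ β := C β / (Z β · recordGamma L Ω β)`.)
So (B-T) is EXACTLY: the Laplace asymptotics of ONE colour-localised gauge-orbit × fibre integral against the RAW one-site kernel `exp(B[Σ_k Re tr(u_k u'_k⁻¹) − ½(S₁(u)+S₁(u'))])`,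
pointwise on the window, to relative precision `κ = O(β^{-2s} + β^{-1/2}polylog)` (§25.3: critical point at the constant lift, `21(|Site|−1)`-dimensional Gaussian, determinant
second order in the slow datum by the colour trace `…InnerSymmetry`).
HONEST FRAMING: exact symmetry bookkeeping (Fubini + invariance of Haar); the Laplace core of (B-T) is OPEN; C4-CORE OPEN; stub of a child of the CONDITIONAL route R2b1;
not infinite volume, not a gap, not Clay.
-/

set_option autoImplicit false

noncomputable section

open MeasureTheory Filter Topology Real
open scoped BigOperators
open Literature.MathematicalPhysics.QuantumFieldTheory
open Literature.MathematicalPhysics.QuantumLattice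

namespace Summit.QuantumFields.YangMills.Theorems.FemtoTransferGap.TwoLattice.ConstTube

open Summit.QuantumFields.YangMills.Theorems.FemtoTransferGap
open Summit.QuantumFields.YangMills.Theorems.FemtoTransferGap.TwoLattice.Avg
open Summit.QuantumFields.YangMills.Theorems.FemtoTransferGap.TwoLattice.Stiff (LinkSpace)

variable {L : ℕ} [NeZero L]

/-! ## §1 The Faddeev–Popov identity for the global colour action on the gauge group -/

omit [NeZero L] in
/-- `(c, g) ↦ c·g` (left translation of every site value by the same colour rotation) is jointly measurable. [folklore] -/
theorem measurable_colourMul : Measurable fun p : SU2 × (Site 3 L → SU2) => fun x => p.1 * p.2 x := by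
  haveI : SecondCountableTopology SU2 := secondCountableTopology_su2
  exact measurable_pi_lambda _ fun x => measurable_fst.mul ((measurable_pi_apply x).comp measurable_snd)

omit [NeZero L] in
/-- `(c, g) ↦ c⁻¹·g` is jointly measurable. [folklore] -/
theorem measurable_colourInvMul : Measurable fun p : SU2 × (Site 3 L → SU2) => fun x => p.1⁻¹ * p.2 x := by
  haveI : SecondCountableTopology SU2 := secondCountableTopology_su2
  exact measurable_pi_lambda _ fun x => measurable_fst.inv.mul ((measurable_pi_apply x).comp measurable_snd)

/-- ★★ **Faddeev–Popov for the global colour action.**  If the colour-orbit integral of the weight `W` is the constant `Z` (`∫_c W(c·g) dc = Z` for every `g`), then for every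
bounded measurable `F` on the gauge group `Z·∫ F(g) dg = ∫_c ∫_g F(c·g)·W(g) dg dc`. [cite: SeilerLNP1982, §2] -/
theorem integral_gaugeMeasure_fp {W : (Site 3 L → SU2) → ℝ} (hW : Measurable W) {CW : ℝ} (hCW : ∀ g, |W g| ≤ CW) {Z : ℝ}
    (hZ : ∀ g : Site 3 L → SU2, ∫ c, W (fun x => c * g x) ∂haarProbability SU2 = Z)
    {F : (Site 3 L → SU2) → ℝ} (hF : Measurable F) {C : ℝ} (hC : ∀ g, |F g| ≤ C) :
    Z * ∫ g, F g ∂gaugeMeasure L = ∫ c, ∫ g, F (fun x => c * g x) * W g ∂gaugeMeasure L ∂haarProbability SU2 := by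
  have hC0 : 0 ≤ C := (abs_nonneg _).trans (hC 1)
  -- Step 1: left invariance of the gauge-group Haar measure under the constant translation `c⁻¹`
  have h1 : ∀ c : SU2, ∫ g, F (fun x => c * g x) * W g ∂gaugeMeasure L = ∫ g, F g * W (fun x => c⁻¹ * g x) ∂gaugeMeasure L := fun c => by
    have h := integral_mul_left_eq_self (μ := gaugeMeasure L) (fun g : Site 3 L → SU2 => F (fun x => c * g x) * W g) (fun _ => c⁻¹)
    rw [← h]
    refine integral_congr_ae (ae_of_all _ fun g => ?_)
    dsimp only
    have e : (fun x => c * ((fun _ : Site 3 L => c⁻¹) * g) x) = g := by funext x; simp [Pi.mul_apply]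
    rw [e]
    rfl
  simp_rw [h1]
  -- Step 2: Fubini
  have hJ : Measurable fun p : SU2 × (Site 3 L → SU2) => F p.2 * W (fun x => p.1⁻¹ * p.2 x) :=
    (hF.comp measurable_snd).mul (hW.comp measurable_colourInvMul)
  have hint : Integrable (fun p : SU2 × (Site 3 L → SU2) => F p.2 * W (fun x => p.1⁻¹ * p.2 x)) ((haarProbability SU2).prod (gaugeMeasure L)) :=
    integrable_of_measurable_abs_le _ hJ (C := C * CW) fun p => by rw [abs_mul]; exact mul_le_mul (hC _) (hCW _) (abs_nonneg _) hC0
  rw [integral_integral_swap hint]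
  -- Step 3: the orbit integral of the weight is `Z` (inversion invariance of Haar on `SU(2)`)
  have h3 : ∀ g : Site 3 L → SU2, ∫ c, F g * W (fun x => c⁻¹ * g x) ∂haarProbability SU2 = F g * Z := fun g => by
    rw [integral_const_mul, integral_inv_eq_self (fun c : SU2 => W (fun x => c * g x)) (haarProbability SU2), hZ g]
  simp_rw [h3]
  rw [integral_mul_const, mul_comm]

omit [NeZero L] in
/-- **The weight of an equivariant mean**: if `μ(c·g) = c·μ(g)` then `W = Θ ∘ μ` has constant colour-orbit integral `∫ Θ` (right invariance of Haar). [folklore] -/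
theorem fp_weight_of_equivariant (Θ : SU2 → ℝ) {μ : (Site 3 L → SU2) → SU2} (hμ : ∀ (c : SU2) (g : Site 3 L → SU2), μ (fun x => c * g x) = c * μ g)
    (g : Site 3 L → SU2) : ∫ c, Θ (μ (fun x => c * g x)) ∂haarProbability SU2 = ∫ c, Θ c ∂haarProbability SU2 := by
  simp_rw [hμ]
  exact integral_mul_right_eq_self Θ (μ g)

/-! ## §2 The averaged kernel and the one-site kernel through the colour integral -/

/-- `c·(V^g) = (c·g)·V`-bookkeeping: `K_β(U, (c·g)·V) = K_β(c⁻¹Uc, V^g)`. [folklore] -/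
theorem transferKernel_colourMul (β : ℝ) (c : SU2) (g : Site 3 L → SU2) (U V : GaugeConfig 3 L SU2) :
    transferKernel su2Rep β U (gaugeTransform (fun x => c * g x) V) =
      transferKernel su2Rep β (gaugeTransform (fun _ : Site 3 L => c⁻¹) U) (gaugeTransform g V) := by
  have e1 : (fun x => c * g x) = (fun _ : Site 3 L => c) * g := rfl
  rw [e1, ← gaugeTransform_gaugeTransform, ← transferKernel_gaugeTransform su2Rep β (fun _ : Site 3 L => c⁻¹) U, gaugeTransform_gaugeTransform]
  have e2 : ((fun _ : Site 3 L => c⁻¹) * fun _ : Site 3 L => c) = 1 := by funext x; simp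
  rw [e2, TT.gaugeTransform_one']

/-- ★ **`Z·K̃_β(U,V) = ∫_c ∫_g W(g)·K_β(c⁻¹Uc, V^g) dg dc`.** [cite: SeilerLNP1982, §3] -/
theorem avgKernel_fp (β : ℝ) {W : (Site 3 L → SU2) → ℝ} (hW : Measurable W) {CW : ℝ} (hCW : ∀ g, |W g| ≤ CW) {Z : ℝ}
    (hZ : ∀ g : Site 3 L → SU2, ∫ c, W (fun x => c * g x) ∂haarProbability SU2 = Z) (U V : GaugeConfig 3 L SU2) :
    Z * avgKernel β U V = ∫ c, ∫ g, W g * transferKernel su2Rep β (gaugeTransform (fun _ : Site 3 L => c⁻¹) U) (gaugeTransform g V) ∂gaugeMeasure L ∂haarProbability SU2 := by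
  haveI : SecondCountableTopology SU2 := secondCountableTopology_su2
  obtain ⟨M, hM⟩ := exists_transferKernel_le su2Rep continuous_su2Rep β (L := L)
  unfold avgKernel
  rw [integral_gaugeMeasure_fp hW hCW hZ (measurable_transferKernel_gaugeTransform_right β U V) (C := M)
    (fun g => by rw [abs_of_pos (transferKernel_pos su2Rep β _ _)]; exact hM _ _)]
  refine integral_congr_ae (ae_of_all _ fun c => integral_congr_ae (ae_of_all _ fun g => ?_))
  dsimp only
  rw [transferKernel_colourMul, mul_comm]

/-- `K₁^{(B)}(u, cu'c⁻¹) = K₁^{(B)}(c⁻¹uc, u')`. [folklore] -/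
theorem transferKernel_conj_right_eq {M : ℕ} [NeZero M] (B : ℝ) (c : SU2) (u u' : GaugeConfig 3 M SU2) :
    transferKernel su2Rep B u (gaugeTransform (fun _ : Site 3 M => c) u') = transferKernel su2Rep B (gaugeTransform (fun _ : Site 3 M => c⁻¹) u) u' := by
  rw [← transferKernel_gaugeTransform su2Rep B (fun _ : Site 3 M => c⁻¹) u, gaugeTransform_const_const, inv_mul_cancel]
  have e2 : (fun _ : Site 3 M => (1 : SU2)) = 1 := rfl
  rw [e2, TT.gaugeTransform_one']

/-- ★ **The one-site averaged kernel is a colour integral**: `K̃₁^{(B)}(u,u') = ∫_c K₁^{(B)}(c⁻¹uc, u') dc`. [cite: Luscher1983, §3] -/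
theorem avgKernel_one_eq_integral_conj (B : ℝ) (u u' : GaugeConfig 3 1 SU2) :
    avgKernel B u u' = ∫ c, transferKernel su2Rep B (gaugeTransform (fun _ : Site 3 1 => c⁻¹) u) u' ∂haarProbability SU2 := by
  unfold avgKernel
  have hmp := measurePreserving_funUnique (haarProbability SU2) (Site 3 1)
  have h := MeasurePreserving.integral_comp' (G := ℝ) hmp (fun c : SU2 => transferKernel su2Rep B (gaugeTransform (fun _ : Site 3 1 => c⁻¹) u) u')
  have hF : (Unique.fintype : Fintype (Site 3 1)) = Pi.instFintype := Subsingleton.elim _ _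
  rw [hF] at h
  have e : (gaugeMeasure 1 : Measure (Site 3 1 → SU2)) = Measure.pi (fun _ : Site 3 1 => haarProbability SU2) := rfl
  rw [e]
  refine Eq.trans (integral_congr_ae (ae_of_all _ fun g => ?_)) h
  dsimp only
  rw [gaugeTransform_one_site_eq_const g u', transferKernel_conj_right_eq]
  have hg : g 0 = (MeasurableEquiv.funUnique (Site 3 1) SU2) g := by
    simp only [MeasurableEquiv.funUnique_apply]; exact congrArg g (Subsingleton.elim _ _)
  rw [hg]

/-! ## §3 The colour-localised BO kernel `fpBOKernel` and `Z·𝒦 = ∫_c fpBOKernel(c⁻¹uc, u') dc` -/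

variable (L) in
/-- **The colour-localised Born–Oppenheimer kernel** `fpBOKernel β Ω W u u' = ∫∫ Ω(v)·(∫_g W(g)·K_β(orthoTube u v, (orthoTube u' v')^g) dg)·Ω(v') dπ(v) dπ(v')`: the BO kernel
with the gauge-orbit integral restricted by the Faddeev–Popov weight `W` (of record: `W` = indicator that the polar colour mean of `g` is `β^{-1}`-close to `1`). [cite: Luscher1983, §3] -/
def fpBOKernel (β : ℝ) (Ω : LinkSpace L → ℝ) (W : (Site 3 L → SU2) → ℝ) (u u' : GaugeConfig 3 1 SU2) : ℝ :=
  ∫ v, Ω (linkEmbed L v) * ∫ v', (∫ g, W g * transferKernel su2Rep β (orthoTube L u v) (gaugeTransform g (orthoTube L u' v')) ∂gaugeMeasure L) * Ω (linkEmbed L v')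
    ∂orthoTransverse L ∂orthoTransverse L

/-- `linkEmbed (Ad_c v) = adL c (linkEmbed v)`. [folklore] -/
theorem linkEmbed_colourRotate_const (c : SU2) (v : Edge 3 L → Fin 3 → ℝ) : linkEmbed L (colourRotate L (fun _ => c) v) = adL L c (linkEmbed L v) := by
  ext ea
  rw [show ea = (ea.1, ea.2) from rfl, adL_apply, adLin_apply, linkEmbed_apply]
  rfl

/-- The four-variable integrand `((v,v'),c,g) ↦ W(g)·K_β(c⁻¹(orthoTube u v)c, (orthoTube u' v')^g)` is jointly measurable. [folklore] -/
theorem measurable_fp_integrand (β : ℝ) {W : (Site 3 L → SU2) → ℝ} (hW : Measurable W) (u u' : GaugeConfig 3 1 SU2) :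
    Measurable fun q : (((Edge 3 L → Fin 3 → ℝ) × (Edge 3 L → Fin 3 → ℝ)) × SU2) × (Site 3 L → SU2) =>
      W q.2 * transferKernel su2Rep β (gaugeTransform (fun _ : Site 3 L => q.1.2⁻¹) (orthoTube L u q.1.1.1)) (gaugeTransform q.2 (orthoTube L u' q.1.1.2)) := by
  haveI : SecondCountableTopology SU2 := secondCountableTopology_su2
  have hK : Measurable fun p : GaugeConfig 3 L SU2 × GaugeConfig 3 L SU2 => transferKernel su2Rep β p.1 p.2 :=
    (continuous_transferKernel su2Rep continuous_su2Rep β).measurable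
  have h1 : Measurable fun q : (((Edge 3 L → Fin 3 → ℝ) × (Edge 3 L → Fin 3 → ℝ)) × SU2) × (Site 3 L → SU2) =>
      gaugeTransform (fun _ : Site 3 L => q.1.2⁻¹) (orthoTube L u q.1.1.1) := by
    have ha : Measurable fun q : (((Edge 3 L → Fin 3 → ℝ) × (Edge 3 L → Fin 3 → ℝ)) × SU2) × (Site 3 L → SU2) => (orthoTube L u q.1.1.1, q.1.2⁻¹) :=
      ((measurable_orthoTube_right (L := L) u).comp (measurable_fst.comp (measurable_fst.comp measurable_fst))).prodMk
        (measurable_snd.comp measurable_fst).inv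
    have h := (measurable_constGaugeAction (L := L)).comp ha
    simpa only [Function.comp_def] using h
  have h2 : Measurable fun q : (((Edge 3 L → Fin 3 → ℝ) × (Edge 3 L → Fin 3 → ℝ)) × SU2) × (Site 3 L → SU2) => gaugeTransform q.2 (orthoTube L u' q.1.1.2) := by
    have ha : Measurable fun q : (((Edge 3 L → Fin 3 → ℝ) × (Edge 3 L → Fin 3 → ℝ)) × SU2) × (Site 3 L → SU2) => (orthoTube L u' q.1.1.2, q.2) :=
      ((measurable_orthoTube_right (L := L) u').comp (measurable_snd.comp (measurable_fst.comp measurable_fst))).prodMk measurable_snd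
    have h := (measurable_gaugeAction (L := L)).comp ha
    simpa only [Function.comp_def] using h
  have h3 := hK.comp (h1.prodMk h2)
  have h3' : Measurable fun q : (((Edge 3 L → Fin 3 → ℝ) × (Edge 3 L → Fin 3 → ℝ)) × SU2) × (Site 3 L → SU2) =>
      transferKernel su2Rep β (gaugeTransform (fun _ : Site 3 L => q.1.2⁻¹) (orthoTube L u q.1.1.1)) (gaugeTransform q.2 (orthoTube L u' q.1.1.2)) := by
    simpa only [Function.comp_def] using h3
  exact (hW.comp measurable_snd).mul h3'

/-- ★★ **`Z·𝒦_β(u,u') = ∫_c fpBOKernel(c⁻¹uc, u') dc`** for colour-blind bounded measurable `Ω` and an FP weight `W` (and the integrand is integrable in `c`).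
[cite: Luscher1983, §3] -/
theorem boKernel_fp (β : ℝ) {Ω : LinkSpace L → ℝ} (hΩm : Measurable Ω) {CΩ : ℝ} (hCΩ : ∀ x, |Ω x| ≤ CΩ) (hΩinv : ∀ (g : SU2) (x : LinkSpace L), Ω (adL L g x) = Ω x)
    {W : (Site 3 L → SU2) → ℝ} (hW : Measurable W) {CW : ℝ} (hCW : ∀ g, |W g| ≤ CW) {Z : ℝ}
    (hZ : ∀ g : Site 3 L → SU2, ∫ c, W (fun x => c * g x) ∂haarProbability SU2 = Z) (u u' : GaugeConfig 3 1 SU2) :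
    Integrable (fun c : SU2 => fpBOKernel L β Ω W (gaugeTransform (fun _ : Site 3 1 => c⁻¹) u) u') (haarProbability SU2) ∧
      Z * boKernel L β Ω u u' = ∫ c, fpBOKernel L β Ω W (gaugeTransform (fun _ : Site 3 1 => c⁻¹) u) u' ∂haarProbability SU2 := by
  haveI := isFiniteMeasure_orthoTransverse L
  haveI : SecondCountableTopology SU2 := secondCountableTopology_su2
  obtain ⟨M, hM⟩ := exists_transferKernel_le su2Rep continuous_su2Rep β (L := L)
  have hM0 : 0 ≤ M := (transferKernel_pos su2Rep β (1 : GaugeConfig 3 L SU2) 1).le.trans (hM 1 1)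
  have hCΩ0 : 0 ≤ CΩ := (abs_nonneg _).trans (hCΩ 0)
  have hCW0 : 0 ≤ CW := (abs_nonneg _).trans (hCW 1)
  set P : ℝ := (orthoTransverse L).real Set.univ with hP
  -- the `g`-integral `G((v,v'),c) = ∫ W(g) K(c⁻¹(oT u v)c, (oT u' v')^g) dg`
  set G : ((Edge 3 L → Fin 3 → ℝ) × (Edge 3 L → Fin 3 → ℝ)) × SU2 → ℝ := fun t =>
    ∫ g, W g * transferKernel su2Rep β (gaugeTransform (fun _ : Site 3 L => t.2⁻¹) (orthoTube L u t.1.1)) (gaugeTransform g (orthoTube L u' t.1.2)) ∂gaugeMeasure L with hG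
  have h4 := measurable_fp_integrand (L := L) β hW u u'
  have hGm : Measurable G := by
    have h := (h4.stronglyMeasurable.integral_prod_right' (ν := gaugeMeasure L)).measurable
    rw [hG]; simpa only using h
  have hGb : ∀ t, |G t| ≤ CW * M := fun t => by
    rw [hG]; dsimp only
    calc |∫ g, W g * transferKernel su2Rep β (gaugeTransform (fun _ : Site 3 L => t.2⁻¹) (orthoTube L u t.1.1)) (gaugeTransform g (orthoTube L u' t.1.2)) ∂gaugeMeasure L|
        ≤ ∫ g, |W g * transferKernel su2Rep β (gaugeTransform (fun _ : Site 3 L => t.2⁻¹) (orthoTube L u t.1.1)) (gaugeTransform g (orthoTube L u' t.1.2))| ∂gaugeMeasure L :=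
          abs_integral_le_integral_abs
      _ ≤ ∫ _g, CW * M ∂gaugeMeasure L :=
          integral_mono_of_nonneg (ae_of_all _ fun _ => abs_nonneg _) (integrable_const _) (ae_of_all _ fun g => by
            show |W g * _| ≤ CW * M
            rw [abs_mul, abs_of_pos (transferKernel_pos su2Rep β _ _)]
            exact mul_le_mul (hCW g) (hM _ _) (transferKernel_pos su2Rep β _ _).le hCW0)
      _ = CW * M := by simp
  -- Step 1: insert the FP form of the averaged kernel
  have hstep1 : Z * boKernel L β Ω u u' =
      ∫ v, Ω (linkEmbed L v) * ∫ v', (∫ c, G ((v, v'), c) ∂haarProbability SU2) * Ω (linkEmbed L v') ∂orthoTransverse L ∂orthoTransverse L := by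
    unfold boKernel
    rw [← integral_const_mul]
    refine integral_congr_ae (ae_of_all _ fun v => ?_)
    dsimp only
    rw [mul_left_comm, ← integral_const_mul]
    congr 1
    refine integral_congr_ae (ae_of_all _ fun v' => ?_)
    dsimp only
    rw [← mul_assoc, avgKernel_fp β hW hCW hZ]
  -- Step 2: swap `v' ↔ c` (for each `v`) and `v ↔ c`
  have hF3m : Measurable fun q : ((Edge 3 L → Fin 3 → ℝ) × (Edge 3 L → Fin 3 → ℝ)) × SU2 => G q * Ω (linkEmbed L q.1.2) :=
    hGm.mul (hΩm.comp ((measurable_linkEmbed L).comp (measurable_snd.comp measurable_fst)))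
  have hswap1 : ∀ v : Edge 3 L → Fin 3 → ℝ,
      ∫ v', (∫ c, G ((v, v'), c) ∂haarProbability SU2) * Ω (linkEmbed L v') ∂orthoTransverse L =
        ∫ c, ∫ v', G ((v, v'), c) * Ω (linkEmbed L v') ∂orthoTransverse L ∂haarProbability SU2 := fun v => by
    have hm : Measurable fun p : (Edge 3 L → Fin 3 → ℝ) × SU2 => G ((v, p.1), p.2) * Ω (linkEmbed L p.1) := by
      have hp : Measurable fun p : (Edge 3 L → Fin 3 → ℝ) × SU2 => (((v, p.1), p.2) : ((Edge 3 L → Fin 3 → ℝ) × (Edge 3 L → Fin 3 → ℝ)) × SU2) :=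
        ((measurable_const.prodMk measurable_fst).prodMk measurable_snd)
      have h := hF3m.comp hp
      simpa only [Function.comp_def] using h
    have hint : Integrable (fun p : (Edge 3 L → Fin 3 → ℝ) × SU2 => G ((v, p.1), p.2) * Ω (linkEmbed L p.1)) ((orthoTransverse L).prod (haarProbability SU2)) :=
      integrable_of_measurable_abs_le _ hm (C := CW * M * CΩ) fun p => by
        rw [abs_mul]; exact mul_le_mul (hGb _) (hCΩ _) (abs_nonneg _) (mul_nonneg hCW0 hM0)
    have e : ∀ v', (∫ c, G ((v, v'), c) ∂haarProbability SU2) * Ω (linkEmbed L v') = ∫ c, G ((v, v'), c) * Ω (linkEmbed L v') ∂haarProbability SU2 := fun v' => by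
      rw [← integral_mul_const]
    simp_rw [e]
    exact integral_integral_swap hint
  simp_rw [hswap1] at hstep1
  -- the `(v, c)`-integrand after the inner swap
  have hHm : Measurable fun p : (Edge 3 L → Fin 3 → ℝ) × SU2 => Ω (linkEmbed L p.1) * ∫ v', G ((p.1, v'), p.2) * Ω (linkEmbed L v') ∂orthoTransverse L := by
    have hr : Measurable fun r : ((Edge 3 L → Fin 3 → ℝ) × SU2) × (Edge 3 L → Fin 3 → ℝ) => G ((r.1.1, r.2), r.1.2) * Ω (linkEmbed L r.2) := by
      have hp : Measurable fun r : ((Edge 3 L → Fin 3 → ℝ) × SU2) × (Edge 3 L → Fin 3 → ℝ) =>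
          (((r.1.1, r.2), r.1.2) : ((Edge 3 L → Fin 3 → ℝ) × (Edge 3 L → Fin 3 → ℝ)) × SU2) :=
        ((measurable_fst.comp measurable_fst).prodMk measurable_snd).prodMk (measurable_snd.comp measurable_fst)
      have h := hF3m.comp hp
      simpa only [Function.comp_def] using h
    have hI := (hr.stronglyMeasurable.integral_prod_right' (ν := orthoTransverse L)).measurable
    have hI' : Measurable fun p : (Edge 3 L → Fin 3 → ℝ) × SU2 => ∫ v', G ((p.1, v'), p.2) * Ω (linkEmbed L v') ∂orthoTransverse L := by
      simpa only using hI
    exact (hΩm.comp ((measurable_linkEmbed L).comp measurable_fst)).mul hI'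
  have hHb : ∀ p : (Edge 3 L → Fin 3 → ℝ) × SU2, |Ω (linkEmbed L p.1) * ∫ v', G ((p.1, v'), p.2) * Ω (linkEmbed L v') ∂orthoTransverse L| ≤ CΩ * (CW * M * CΩ * P) :=
    fun p => by
      rw [abs_mul]
      refine mul_le_mul (hCΩ _) ?_ (abs_nonneg _) hCΩ0
      calc |∫ v', G ((p.1, v'), p.2) * Ω (linkEmbed L v') ∂orthoTransverse L| ≤ ∫ v', |G ((p.1, v'), p.2) * Ω (linkEmbed L v')| ∂orthoTransverse L :=
            abs_integral_le_integral_abs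
        _ ≤ ∫ _v', CW * M * CΩ ∂orthoTransverse L :=
            integral_mono_of_nonneg (ae_of_all _ fun _ => abs_nonneg _) (integrable_const _) (ae_of_all _ fun v' => by
              show |G ((p.1, v'), p.2) * Ω (linkEmbed L v')| ≤ CW * M * CΩ
              rw [abs_mul]; exact mul_le_mul (hGb _) (hCΩ _) (abs_nonneg _) (mul_nonneg hCW0 hM0))
        _ = CW * M * CΩ * P := by rw [integral_const, smul_eq_mul, hP]; ring
  have hswap2 : ∫ v, Ω (linkEmbed L v) * ∫ c, ∫ v', G ((v, v'), c) * Ω (linkEmbed L v') ∂orthoTransverse L ∂haarProbability SU2 ∂orthoTransverse L =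
      ∫ c, ∫ v, Ω (linkEmbed L v) * ∫ v', G ((v, v'), c) * Ω (linkEmbed L v') ∂orthoTransverse L ∂orthoTransverse L ∂haarProbability SU2 := by
    have hint : Integrable (fun p : (Edge 3 L → Fin 3 → ℝ) × SU2 => Ω (linkEmbed L p.1) * ∫ v', G ((p.1, v'), p.2) * Ω (linkEmbed L v') ∂orthoTransverse L)
        ((orthoTransverse L).prod (haarProbability SU2)) := integrable_of_measurable_abs_le _ hHm hHb
    have e : ∀ v, Ω (linkEmbed L v) * ∫ c, ∫ v', G ((v, v'), c) * Ω (linkEmbed L v') ∂orthoTransverse L ∂haarProbability SU2 =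
        ∫ c, Ω (linkEmbed L v) * ∫ v', G ((v, v'), c) * Ω (linkEmbed L v') ∂orthoTransverse L ∂haarProbability SU2 := fun v => by rw [integral_const_mul]
    simp_rw [e]
    exact integral_integral_swap hint
  rw [hswap2] at hstep1
  -- Step 3: for each `c`, the `v`-integrand is the `fpBOKernel` integrand at the conjugated slow point, rotated by `Ad_{c⁻¹}`
  have hfibre : ∀ c : SU2, ∫ v, Ω (linkEmbed L v) * ∫ v', G ((v, v'), c) * Ω (linkEmbed L v') ∂orthoTransverse L ∂orthoTransverse L =
      fpBOKernel L β Ω W (gaugeTransform (fun _ : Site 3 1 => c⁻¹) u) u' := fun c => by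
    -- the `fpBOKernel` `v`-integrand at the conjugated slow point `c⁻¹uc`
    set Ψ : (Edge 3 L → Fin 3 → ℝ) → ℝ := fun w => Ω (linkEmbed L w) *
      ∫ v', (∫ g, W g * transferKernel su2Rep β (orthoTube L (gaugeTransform (fun _ : Site 3 1 => c⁻¹) u) w) (gaugeTransform g (orthoTube L u' v')) ∂gaugeMeasure L) *
        Ω (linkEmbed L v') ∂orthoTransverse L with hΨ
    have hΨm : Measurable Ψ := by
      -- the same measurability chain at the slow point `c⁻¹uc` and colour `1`
      have h4' := measurable_fp_integrand (L := L) β hW (gaugeTransform (fun _ : Site 3 1 => c⁻¹) u) u'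
      have hG' := (h4'.stronglyMeasurable.integral_prod_right' (ν := gaugeMeasure L)).measurable
      have hG'' : Measurable fun t : ((Edge 3 L → Fin 3 → ℝ) × (Edge 3 L → Fin 3 → ℝ)) × SU2 =>
          ∫ g, W g * transferKernel su2Rep β (gaugeTransform (fun _ : Site 3 L => t.2⁻¹) (orthoTube L (gaugeTransform (fun _ : Site 3 1 => c⁻¹) u) t.1.1))
            (gaugeTransform g (orthoTube L u' t.1.2)) ∂gaugeMeasure L := by
        simpa only using hG'
      have hsec : Measurable fun r : (Edge 3 L → Fin 3 → ℝ) × (Edge 3 L → Fin 3 → ℝ) =>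
          (∫ g, W g * transferKernel su2Rep β (gaugeTransform (fun _ : Site 3 L => (1 : SU2)⁻¹) (orthoTube L (gaugeTransform (fun _ : Site 3 1 => c⁻¹) u) r.1))
            (gaugeTransform g (orthoTube L u' r.2)) ∂gaugeMeasure L) * Ω (linkEmbed L r.2) := by
        have hp : Measurable fun r : (Edge 3 L → Fin 3 → ℝ) × (Edge 3 L → Fin 3 → ℝ) => ((r, (1 : SU2)) : ((Edge 3 L → Fin 3 → ℝ) × (Edge 3 L → Fin 3 → ℝ)) × SU2) :=
          measurable_id.prodMk measurable_const
        have h := hG''.comp hp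
        have h' : Measurable fun r : (Edge 3 L → Fin 3 → ℝ) × (Edge 3 L → Fin 3 → ℝ) =>
            ∫ g, W g * transferKernel su2Rep β (gaugeTransform (fun _ : Site 3 L => (1 : SU2)⁻¹) (orthoTube L (gaugeTransform (fun _ : Site 3 1 => c⁻¹) u) r.1))
              (gaugeTransform g (orthoTube L u' r.2)) ∂gaugeMeasure L := by
          simpa only [Function.comp_def] using h
        exact h'.mul (hΩm.comp ((measurable_linkEmbed L).comp measurable_snd))
      have hone : ∀ U : GaugeConfig 3 L SU2, gaugeTransform (fun _ : Site 3 L => (1 : SU2)⁻¹) U = U := fun U => by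
        rw [inv_one]; exact TT.gaugeTransform_one' U
      simp only [hone] at hsec
      have hI := (hsec.stronglyMeasurable.integral_prod_right' (ν := orthoTransverse L)).measurable
      have hI' : Measurable fun w : Edge 3 L → Fin 3 → ℝ =>
          ∫ v', (∫ g, W g * transferKernel su2Rep β (orthoTube L (gaugeTransform (fun _ : Site 3 1 => c⁻¹) u) w) (gaugeTransform g (orthoTube L u' v')) ∂gaugeMeasure L) *
            Ω (linkEmbed L v') ∂orthoTransverse L := by
        simpa only using hI
      rw [hΨ]
      exact (hΩm.comp (measurable_linkEmbed L)).mul hI'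
    -- pointwise identity on the cap
    have hcap : ∀ᵐ v ∂orthoTransverse L, v ∈ capBalancedSet L := by
      rw [ae_iff]
      have h0 := orthoTransverse_compl_capBalancedSet L
      simpa only [Set.compl_def] using h0
    have hpt : ∀ᵐ v ∂orthoTransverse L, Ω (linkEmbed L v) * ∫ v', G ((v, v'), c) * Ω (linkEmbed L v') ∂orthoTransverse L = Ψ (colourRotate L (fun _ => c⁻¹) v) := by
      filter_upwards [hcap] with v hv
      rw [hΨ, hG]; dsimp only
      have hv1 : ∀ e : Edge 3 L, ∑ a, v e a ^ 2 ≤ 1 := sum_sq_le_one_of_cap L hv.2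
      rw [linkEmbed_colourRotate_const, hΩinv]
      congr 1
      refine integral_congr_ae (ae_of_all _ fun v' => ?_)
      dsimp only
      rw [Summit.QuantumFields.YangMills.Theorems.TwistedTraceScaling.Negative.R33.gaugeTransform_const_orthoTube c⁻¹ u hv1]
    rw [integral_congr_ae hpt, integral_orthoTransverse_colourRotate L (fun _ => c⁻¹) Ψ hΨm, hΨ]
    rfl
  refine ⟨?_, ?_⟩
  · have hint : Integrable (fun c : SU2 => ∫ v, Ω (linkEmbed L v) * ∫ v', G ((v, v'), c) * Ω (linkEmbed L v') ∂orthoTransverse L ∂orthoTransverse L) (haarProbability SU2) := by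
      have hsw : Measurable fun p : SU2 × (Edge 3 L → Fin 3 → ℝ) => Ω (linkEmbed L p.2) * ∫ v', G ((p.2, v'), p.1) * Ω (linkEmbed L v') ∂orthoTransverse L := by
        have h := hHm.comp (measurable_snd.prodMk measurable_fst : Measurable fun p : SU2 × (Edge 3 L → Fin 3 → ℝ) => (p.2, p.1))
        simpa only [Function.comp_def] using h
      have hI := (hsw.stronglyMeasurable.integral_prod_right' (ν := orthoTransverse L)).measurable
      have hI' : Measurable fun c : SU2 => ∫ v, Ω (linkEmbed L v) * ∫ v', G ((v, v'), c) * Ω (linkEmbed L v') ∂orthoTransverse L ∂orthoTransverse L := by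
        simpa only using hI
      refine integrable_of_measurable_abs_le _ hI' (C := CΩ * (CW * M * CΩ * P) * P) fun c => ?_
      calc |∫ v, Ω (linkEmbed L v) * ∫ v', G ((v, v'), c) * Ω (linkEmbed L v') ∂orthoTransverse L ∂orthoTransverse L|
          ≤ ∫ v, |Ω (linkEmbed L v) * ∫ v', G ((v, v'), c) * Ω (linkEmbed L v') ∂orthoTransverse L| ∂orthoTransverse L := abs_integral_le_integral_abs
        _ ≤ ∫ _v, CΩ * (CW * M * CΩ * P) ∂orthoTransverse L :=
            integral_mono_of_nonneg (ae_of_all _ fun _ => abs_nonneg _) (integrable_const _) (ae_of_all _ fun v => hHb (v, c))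
        _ = CΩ * (CW * M * CΩ * P) * P := by rw [integral_const, smul_eq_mul, hP]; ring
    refine hint.congr (ae_of_all _ fun c => ?_)
    exact hfibre c
  · rw [hstep1]
    exact integral_congr_ae (ae_of_all _ fun c => hfibre c)

end Summit.QuantumFields.YangMills.Theorems.FemtoTransferGap.TwoLattice.ConstTube

end
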